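import Mathlib.Analysis.Fourier.AddCircle
import Mathlib.Analysis.SpecialFunctions.Integrals.Basic
import Mathlib.Analysis.PSeries
import Mathlib.MeasureTheory.Integral.MeanInequalities
import HarnessLib

/-!
# Yoshida's high-mode estimate: the Fourier transform of a function on `(-a, a)` without low
# Fourier modes is uniformly small on compacts

Analysis/Fourier support file (everything proved; no definitions, no named facts).

Let `a > 0`, `N ∈ ℕ` and `ψ ∈ L²(-a, a)` be orthogonal to the `2N + 1` lowest exponentials of
period `2a`, `∫_{-a}^{a} ψ(x) e^{πinx/a} dx = 0` for `|n| ≤ N`. Then for every real `z`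

  `|ψ̂(z)|² ≤ (32 a (1 + a|z|)² / (π² (N + 1))) · ∫_{-a}^{a} |ψ|²`,   `ψ̂(z) = ∫_{-a}^{a} ψ(x) e^{izx} dx`

(`norm_sq_integral_mul_cexp_le_of_fourierCoeff_eq_zero`). This is the estimate behind
Suzuki2023 (4.13) (`∫_{|z| ≤ t₀} |Φ₁(φ;z)|² dz ≪ N^{-1/2} ∫ |Φ₁(φ;z)|² dz` on `𝔎_{N,0}(a)`), proved
"in the same way as [Yo92]": expand `ψ = (2a)^{-1/2} ∑_{|n|>N} c_n e^{πint/a}`, so that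
`|ψ̂(z)| ≤ √(2a) (1 + a|z|) ∑_{|n|>N} |c_n/(πn)| ≤ √(2a)(1 + a|z|)(∑_{|n|>N} (πn)^{-2})^{1/2} ‖ψ‖`
[Suzuki2023, proof of Thm 4.3, pp. 10–11]. The proof below runs the same Parseval/Cauchy–Schwarz
argument in the dual form that needs only Mathlib's Parseval identity on an interval
(`hasSum_sq_fourierCoeffOn`): writing `e_z(x) = e^{-izx}` and `p_N` for its Fourier partial sum of
order `N`, orthogonality gives `ψ̂(z) = ∫ ψ · conj(e_z - p_N)`, Cauchy–Schwarz gives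
`|ψ̂(z)|² ≤ ‖ψ‖² ‖e_z - p_N‖²`, and Parseval gives `‖e_z - p_N‖² = 2a ∑_{|n|>N} |c_n(e_z)|²` with the
elementary bound `|c_n(e_z)| ≤ 2(1 + a|z|)/(π|n|)` (integration of a pure exponential over the
window) and `∑_{|n|>N} n^{-2} ≤ 4/(N+1)`; the constant `32/π²` replaces the printed `2/π²`-type
constant, immaterial for its use (only `→ 0` as `N → ∞`, uniformly for `|z| ≤ t₀`, `a ≤ a₀`, matters).

## References

* M. Suzuki, *Aspects of the screw function corresponding to the Riemann zeta-function*,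
  J. Lond. Math. Soc. (2) 108 (2023) 1448–1487 = arXiv:2206.03682, proof of Thm 4.3, eq. (4.13)
  and the two displays after it (arXiv pp. 10–11). [Suzuki2023]
* H. Yoshida, *On Hermitian forms attached to zeta functions*, Adv. Stud. Pure Math. 21 (1992)
  281–325 (the original estimate on `K_N(a)`). [Yoshida1992]
-/

noncomputable section

open MeasureTheory Set Complex Real Filter Finset
open scoped ComplexConjugate Topology BigOperators

namespace Literature.Analysis.Fourier

/-! ### Window integrals of pure exponentials -/

/-- `‖∫_{-a}^{a} e^{itx} dx‖ ≤ 2a`. [folklore] -/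
private theorem norm_integral_cexp_le_two_mul {a : ℝ} (ha : 0 ≤ a) (t : ℝ) :
    ‖∫ x in (-a)..a, cexp (I * t * x)‖ ≤ 2 * a := by
  have h := intervalIntegral.norm_integral_le_of_norm_le_const (a := -a) (b := a) (C := 1)
    (f := fun x : ℝ ↦ cexp (I * t * x)) (fun x _ ↦ by
      rw [Complex.norm_exp]
      simp)
  have hab : |a - -a| = 2 * a := by rw [sub_neg_eq_add, abs_of_nonneg (by linarith)]; ring
  calc ‖∫ x in (-a)..a, cexp (I * t * x)‖ ≤ 1 * |a - -a| := h
    _ = 2 * a := by rw [hab, one_mul]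

/-- `‖∫_{-a}^{a} e^{itx} dx‖ ≤ 2/|t|` for `t ≠ 0`. [folklore] -/
private theorem norm_integral_cexp_le_two_div {a : ℝ} {t : ℝ} (ht : t ≠ 0) :
    ‖∫ x in (-a)..a, cexp (I * t * x)‖ ≤ 2 / |t| := by
  have hc : I * (t : ℂ) ≠ 0 := mul_ne_zero Complex.I_ne_zero (by exact_mod_cast ht)
  rw [integral_exp_mul_complex hc, norm_div, norm_mul, Complex.norm_I, one_mul,
    Complex.norm_real, Real.norm_eq_abs]
  gcongr
  refine (norm_sub_le _ _).trans ?_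
  rw [Complex.norm_exp, Complex.norm_exp]
  simp only [Complex.mul_re, Complex.I_re, Complex.ofReal_re, zero_mul, Complex.I_im,
    Complex.ofReal_im, mul_zero, sub_zero, Complex.mul_im, one_mul, neg_zero, Real.exp_zero,
    mul_neg]
  norm_num

/-- The window integral of the mode `e^{-i(πn/a + z)x}`, `n ≠ 0`:
`‖∫_{-a}^{a} e^{-i(πn/a+z)x} dx‖ ≤ 4a(1 + a|z|)/(π|n|)` (two cases: `|z| ≤ π|n|/(2a)`, where the
frequency is `≥ π|n|/(2a)` in size, and `|z| > π|n|/(2a)`, where the trivial bound `2a` suffices).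
[cite: Suzuki2023, proof of Thm 4.3, last display (the bound `√(2a)(1+a|z|)|c_n/(πn)|` termwise), arXiv p. 11] -/
theorem norm_integral_cexp_mode_le {a : ℝ} (ha : 0 < a) {n : ℤ} (hn : n ≠ 0) (z : ℝ) :
    ‖∫ x in (-a)..a, cexp (I * ↑(-(π * n / a + z)) * x)‖ ≤
      4 * a * (1 + a * |z|) / (π * |(n : ℝ)|) := by
  have hn' : (0 : ℝ) < |(n : ℝ)| := by positivity
  have hπn : 0 < π * |(n : ℝ)| := by positivity
  have hRHS : 4 * a / (π * |(n : ℝ)|) ≤ 4 * a * (1 + a * |z|) / (π * |(n : ℝ)|) := by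
    refine div_le_div_of_nonneg_right ?_ hπn.le
    exact le_mul_of_one_le_right (by positivity) (by nlinarith [abs_nonneg z, ha.le])
  by_cases hz : |z| ≤ π * |(n : ℝ)| / (2 * a)
  · -- the frequency is bounded below
    have hfreq : π * |(n : ℝ)| / (2 * a) ≤ |-(π * n / a + z)| := by
      rw [abs_neg]
      have h1 : |π * n / a| = π * |(n : ℝ)| / a := by
        rw [abs_div, abs_mul, abs_of_pos Real.pi_pos, abs_of_pos ha]
      have h2 : |π * (n : ℝ) / a| - |z| ≤ |π * n / a + z| := by
        have := abs_add_le (π * n / a + z) (-z)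
        rw [add_neg_cancel_right, abs_neg] at this
        linarith
      rw [h1] at h2
      have h3 : π * |(n : ℝ)| / a - |z| ≥ π * |(n : ℝ)| / (2 * a) := by
        have : π * |(n : ℝ)| / a = 2 * (π * |(n : ℝ)| / (2 * a)) := by
          field_simp
        linarith
      linarith
    have ht : -(π * n / a + z) ≠ 0 := by
      intro h
      rw [h, abs_zero] at hfreq
      have : 0 < π * |(n : ℝ)| / (2 * a) := by positivity
      linarith
    refine (norm_integral_cexp_le_two_div ht).trans (le_trans ?_ hRHS)
    rw [div_le_div_iff₀ (lt_of_lt_of_le (by positivity) hfreq) hπn]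
    calc 2 * (π * |(n : ℝ)|) = 4 * a * (π * |(n : ℝ)| / (2 * a)) := by field_simp; ring
      _ ≤ 4 * a * |-(π * n / a + z)| := by gcongr
  · -- the trivial bound
    push Not at hz
    refine (norm_integral_cexp_le_two_mul ha.le _).trans ?_
    rw [le_div_iff₀ hπn]
    have : π * |(n : ℝ)| < 2 * a * |z| := by
      have := (div_lt_iff₀ (by positivity : (0 : ℝ) < 2 * a)).1 hz
      linarith
    nlinarith [abs_nonneg z, ha]

/-! ### Fourier coefficients on `(-a, a)` of the exponentials -/

/-- The character `fourier (-n)` of period `2a` at a real point: `e^{-πinx/a}`. [folklore] -/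
private theorem fourier_neg_coe_apply {a : ℝ} (ha : 0 < a) (n : ℤ) (x : ℝ) :
    fourier (-n) (x : AddCircle (a - -a)) = cexp (-(I * (π * n / a) * x)) := by
  rw [fourier_coe_apply]
  congr 1
  have ha' : (a : ℂ) ≠ 0 := by exact_mod_cast ha.ne'
  push_cast
  field_simp
  ring

/-- The Fourier coefficients of `x ↦ e^{-izx}` on `(-a, a)` are window integrals of modes:
`c_n(e^{-iz·}) = (1/2a) ∫_{-a}^{a} e^{-i(πn/a + z)x} dx`. [folklore] -/
private theorem fourierCoeffOn_cexp_neg {a : ℝ} (ha : 0 < a) (z : ℝ) (n : ℤ) :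
    fourierCoeffOn (by linarith : -a < a) (fun x : ℝ ↦ cexp (-(I * z * x))) n =
      (1 / (2 * a) : ℝ) • ∫ x in (-a)..a, cexp (I * ↑(-(π * n / a + z)) * x) := by
  rw [fourierCoeffOn_eq_integral]
  have h2a : a - -a = 2 * a := by ring
  rw [h2a]
  congr 1
  refine intervalIntegral.integral_congr fun x _ ↦ ?_
  rw [← h2a, fourier_neg_coe_apply ha, smul_eq_mul, ← Complex.exp_add]
  congr 1
  push_cast
  ring

/-- **The coefficient bound**: `|c_n(e^{-iz·})| ≤ 2(1 + a|z|)/(π|n|)` for `n ≠ 0`.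
[cite: Suzuki2023, proof of Thm 4.3, last display, arXiv p. 11] -/
theorem norm_fourierCoeffOn_cexp_neg_le {a : ℝ} (ha : 0 < a) (z : ℝ) {n : ℤ} (hn : n ≠ 0) :
    ‖fourierCoeffOn (by linarith : -a < a) (fun x : ℝ ↦ cexp (-(I * z * x))) n‖ ≤
      2 * (1 + a * |z|) / (π * |(n : ℝ)|) := by
  rw [fourierCoeffOn_cexp_neg ha, norm_smul, Real.norm_eq_abs, abs_of_pos (by positivity)]
  calc 1 / (2 * a) * ‖∫ x in (-a)..a, cexp (I * ↑(-(π * n / a + z)) * x)‖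
      ≤ 1 / (2 * a) * (4 * a * (1 + a * |z|) / (π * |(n : ℝ)|)) := by
        gcongr
        exact norm_integral_cexp_mode_le ha hn z
    _ = 2 * (1 + a * |z|) / (π * |(n : ℝ)|) := by
        field_simp
        ring

/-- Orthogonality of the modes on the window:
`c_n(e^{πim·/a}) = δ_{nm}` on `(-a, a)`. [folklore] -/
private theorem fourierCoeffOn_mode {a : ℝ} (ha : 0 < a) (m n : ℤ) :
    fourierCoeffOn (by linarith : -a < a) (fun x : ℝ ↦ cexp (I * (π * m / a) * x)) n =
      if n = m then 1 else 0 := by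
  rw [fourierCoeffOn_eq_integral]
  have h2a : a - -a = 2 * a := by ring
  have ha' : (a : ℂ) ≠ 0 := by exact_mod_cast ha.ne'
  have hint : ∫ x in (-a)..a, fourier (-n) (x : AddCircle (a - -a)) • cexp (I * (π * m / a) * x) =
      ∫ x in (-a)..a, cexp ((I * (π * (m - n) / a)) * x) := by
    refine intervalIntegral.integral_congr fun x _ ↦ ?_
    rw [fourier_neg_coe_apply ha, smul_eq_mul, ← Complex.exp_add]
    congr 1
    ring
  rw [hint, h2a]
  split_ifs with hnm
  · subst hnm
    simp only [sub_self, mul_zero, zero_div, zero_mul, Complex.exp_zero,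
      intervalIntegral.integral_const, sub_neg_eq_add, Complex.real_smul]
    push_cast
    field_simp
    ring
  · have hk : ((m - n : ℤ) : ℂ) ≠ 0 := by exact_mod_cast sub_ne_zero.2 (Ne.symm hnm)
    have hw : I * (π * ((m : ℂ) - n) / a) ≠ 0 := by
      have : ((m : ℂ) - n) ≠ 0 := by exact_mod_cast hk
      have hπ : (π : ℂ) ≠ 0 := by exact_mod_cast Real.pi_ne_zero
      exact mul_ne_zero Complex.I_ne_zero (div_ne_zero (mul_ne_zero hπ this) ha')
    rw [integral_exp_mul_complex hw]
    have hper : cexp (I * (π * ((m : ℂ) - n) / a) * (a : ℝ)) =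
        cexp (I * (π * ((m : ℂ) - n) / a) * (-a : ℝ)) := by
      rw [show I * (π * ((m : ℂ) - n) / a) * ((-a : ℝ) : ℂ) = -(I * π * ((m - n : ℤ) : ℂ)) by
        push_cast; field_simp]
      rw [show I * (π * ((m : ℂ) - n) / a) * ((a : ℝ) : ℂ) =
          -(I * π * ((m - n : ℤ) : ℂ)) + ((m - n : ℤ) : ℂ) * (2 * π * I) by
        push_cast; field_simp; ring]
      rw [Complex.exp_add, Complex.exp_int_mul_two_pi_mul_I, mul_one]
    rw [hper, sub_self, zero_div, smul_zero]

/-- Linearity of `fourierCoeffOn` (difference), for continuous integrands. [folklore] -/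
private theorem fourierCoeffOn_sub {a : ℝ} (ha : 0 < a) {f g : ℝ → ℂ} (hf : Continuous f)
    (hg : Continuous g) (n : ℤ) :
    fourierCoeffOn (by linarith : -a < a) (fun x ↦ f x - g x) n =
      fourierCoeffOn (by linarith : -a < a) f n - fourierCoeffOn (by linarith : -a < a) g n := by
  simp only [fourierCoeffOn_eq_integral, smul_sub]
  rw [← smul_sub, ← intervalIntegral.integral_sub]
  · simp_rw [fourier_neg_coe_apply ha, smul_eq_mul]
    exact ((by fun_prop : Continuous fun x : ℝ ↦ cexp (-(I * (π * n / a) * x)) * f x)).intervalIntegrable _ _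
  · simp_rw [fourier_neg_coe_apply ha, smul_eq_mul]
    exact ((by fun_prop : Continuous fun x : ℝ ↦ cexp (-(I * (π * n / a) * x)) * g x)).intervalIntegrable _ _

/-- Linearity of `fourierCoeffOn` (finite sums), for continuous integrands. [folklore] -/
private theorem fourierCoeffOn_finset_sum {a : ℝ} (ha : 0 < a) {ι : Type*} (s : Finset ι)
    {f : ι → ℝ → ℂ} (hf : ∀ i, Continuous (f i)) (n : ℤ) :
    fourierCoeffOn (by linarith : -a < a) (fun x ↦ ∑ i ∈ s, f i x) n =
      ∑ i ∈ s, fourierCoeffOn (by linarith : -a < a) (f i) n := by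
  simp only [fourierCoeffOn_eq_integral]
  rw [← Finset.smul_sum, ← intervalIntegral.integral_finsetSum]
  · congr 1
    refine intervalIntegral.integral_congr fun x _ ↦ ?_
    simp only [Finset.smul_sum]
  · intro i _
    simp_rw [fourier_neg_coe_apply ha, smul_eq_mul]
    exact ((by fun_prop : Continuous fun x : ℝ ↦ cexp (-(I * (π * n / a) * x)) * f i x)).intervalIntegrable _ _

/-! ### The tail `∑_{|n| > N} n⁻²` -/

/-- `∑_{n ∈ ℤ, |n| > N} n⁻² ≤ 4/(N+1)`. [folklore] -/
private theorem tsum_int_inv_sq_tail_le (N : ℕ) :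
    ∑' n : ℤ, (if (N : ℤ) < |n| then 1 / (n : ℝ) ^ 2 else 0) ≤ (4 : ℝ) / ((N : ℝ) + 1) := by
  set e : ℤ → ℝ := fun n ↦ if (N : ℤ) < |n| then 1 / (n : ℝ) ^ 2 else 0 with he
  change ∑' n : ℤ, e n ≤ 4 / ((N : ℝ) + 1)
  have he0 : ∀ n, 0 ≤ e n := fun n ↦ by
    simp only [he]
    split_ifs <;> positivity
  have hele : ∀ n, e n ≤ 1 / (n : ℝ) ^ 2 := fun n ↦ by
    simp only [he]
    split_ifs
    · exact le_rfl
    · positivity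
  have hsum : Summable e :=
    (summable_one_div_int_pow.mpr one_lt_two).of_nonneg_of_le he0 hele
  have hnat_sum : Summable fun n : ℕ ↦ e n := hsum.comp_injective Nat.cast_injective
  have hneg_sum : Summable fun n : ℕ ↦ e (-(n + 1)) :=
    hsum.comp_injective fun x y h ↦ by simpa using h
  -- the `ℕ` part
  have hnat : ∑' n : ℕ, e n ≤ 2 / ((N : ℝ) + 1) := by
    refine Real.tsum_le_of_sum_range_le (fun n ↦ he0 n) fun M ↦ ?_
    have hfilt : ∑ i ∈ Finset.range M, e i = ∑ i ∈ Finset.Ioo N M, ((i : ℝ) ^ 2)⁻¹ := by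
      have : ∀ i : ℕ, e i = if N < i then ((i : ℝ) ^ 2)⁻¹ else 0 := fun i ↦ by
        simp only [he, Int.cast_natCast, one_div, Nat.abs_cast, Nat.cast_lt]
      simp_rw [this]
      rw [← Finset.sum_filter]
      congr 1
      ext i
      simp [Finset.mem_Ioo, and_comm]
    rw [hfilt]
    exact_mod_cast sum_Ioo_inv_sq_le N M
  -- the negative part equals the `ℕ` part without its (vanishing) zeroth term
  have hsymm : ∀ n : ℕ, e (-(n + 1)) = e ((n + 1 : ℕ) : ℤ) := fun n ↦ by
    simp only [he, abs_neg, Int.cast_neg, neg_sq]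
    push_cast
    rfl
  have hzero : e ((0 : ℕ) : ℤ) = 0 := by
    simp [he]
  have hneg : ∑' n : ℕ, e (-(n + 1)) ≤ 2 / ((N : ℝ) + 1) := by
    simp_rw [hsymm]
    have h := hnat_sum.tsum_eq_zero_add
    rw [hzero, zero_add] at h
    rw [← h]
    exact hnat
  rw [tsum_of_nat_of_neg_add_one hnat_sum hneg_sum]
  have h4 : (4 : ℝ) / ((N : ℝ) + 1) = 2 / ((N : ℝ) + 1) + 2 / ((N : ℝ) + 1) := by ring
  rw [h4]
  exact add_le_add hnat hneg

/-! ### Square-integrability of continuous functions on the window -/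

/-- A continuous function is in `L²` of the window `(-a, a]`. [folklore] -/
private theorem memLp_two_Ioc_symm_of_continuous {a : ℝ} {f : ℝ → ℂ} (hf : Continuous f) :
    MemLp f 2 (volume.restrict (Ioc (-a) a)) := by
  obtain ⟨C, hC⟩ := (isCompact_Icc (a := -a) (b := a)).exists_bound_of_continuousOn hf.continuousOn
  have htop : MemLp f ⊤ (volume.restrict (Ioc (-a) a)) := by
    refine memLp_top_of_bound hf.aestronglyMeasurable C ?_
    rw [ae_restrict_iff' measurableSet_Ioc]
    exact Eventually.of_forall fun x hx ↦ hC x (Ioc_subset_Icc_self hx)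
  exact htop.mono_exponent le_top

/-- Cauchy–Schwarz for two square-integrable complex functions:
`‖∫ A B‖ ≤ √(∫ ‖A‖²) √(∫ ‖B‖²)`. [folklore] -/
private theorem norm_integral_mul_le_sqrt_mul_sqrt {μ : Measure ℝ} {A B : ℝ → ℂ}
    (hA : MemLp A 2 μ) (hB : MemLp B 2 μ) :
    ‖∫ x, A x * B x ∂μ‖ ≤ √(∫ x, ‖A x‖ ^ 2 ∂μ) * √(∫ x, ‖B x‖ ^ 2 ∂μ) := by
  refine (norm_integral_le_integral_norm _).trans ?_
  simp only [norm_mul]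
  have h2 : ENNReal.ofReal 2 = 2 := by norm_num
  have hA' : MemLp (fun x ↦ ‖A x‖) (ENNReal.ofReal 2) μ := by rw [h2]; exact hA.norm
  have hB' : MemLp (fun x ↦ ‖B x‖) (ENNReal.ofReal 2) μ := by rw [h2]; exact hB.norm
  have h := integral_mul_le_Lp_mul_Lq_of_nonneg Real.HolderConjugate.two_two
    (ae_of_all _ fun x ↦ norm_nonneg (A x)) (ae_of_all _ fun x ↦ norm_nonneg (B x)) hA' hB'
  simp only [Real.rpow_two] at h
  rw [Real.sqrt_eq_rpow, Real.sqrt_eq_rpow]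
  exact h

/-! ### The estimate -/

/-- **Yoshida's high-mode estimate** (the inequality behind Suzuki2023 (4.13)). Let `a > 0`,
`N ∈ ℕ`, and let `ψ ∈ L²` of the window satisfy `∫_{-a}^{a} ψ(x) e^{iπnx/a} dx = 0` for all integers
`|n| ≤ N`. Then for every real `z`,
`|∫_{-a}^{a} ψ(x) e^{izx} dx|² ≤ (32 a (1 + a|z|)² / (π²(N+1))) ∫_{-a}^{a} |ψ(x)|² dx`.
(Printed: `ψ̂(z) ≤ √(2a)(1 + a|z|)(∑_{|n|>N} (πn)^{-2})^{1/2} ‖ψ‖_{L²}`, "which implies (4.13)";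
the constant here is `4×` the printed one, from the cruder termwise bound
`norm_integral_cexp_mode_le`.)
[cite: Suzuki2023, proof of Thm 4.3, eq. (4.13) and the two displays following it, arXiv pp. 10–11; Yoshida1992] -/
theorem norm_sq_integral_mul_cexp_le_of_fourierCoeff_eq_zero {a : ℝ} (ha : 0 < a) {ψ : ℝ → ℂ}
    (hψ : MemLp ψ 2 (volume.restrict (Ioc (-a) a))) {N : ℕ}
    (horth : ∀ n : ℤ, |n| ≤ N → ∫ x in (-a)..a, ψ x * cexp (I * (π * n / a) * x) = 0) (z : ℝ) :
    ‖∫ x in (-a)..a, ψ x * cexp (I * z * x)‖ ^ 2 ≤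
      32 * a * (1 + a * |z|) ^ 2 / (π ^ 2 * (N + 1)) * ∫ x in (-a)..a, ‖ψ x‖ ^ 2 := by
  have hab : -a < a := by linarith
  have hle : -a ≤ a := hab.le
  -- the Fourier coefficients of `e^{-iz·}` and its Fourier partial sum of order `N`
  set c : ℤ → ℂ := fun n ↦ fourierCoeffOn hab (fun x : ℝ ↦ cexp (-(I * z * x))) n with hc
  set S : Finset ℤ := Finset.Icc (-(N : ℤ)) N with hS
  set q : ℝ → ℂ := fun x ↦ cexp (-(I * z * x)) - ∑ n ∈ S, c n * cexp (I * (π * n / a) * x)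
    with hq
  have hq_cont : Continuous q := by
    simp only [hq]
    fun_prop
  have hmemS : ∀ n : ℤ, n ∈ S ↔ |n| ≤ N := fun n ↦ by
    simp only [hS, Finset.mem_Icc, abs_le]
  -- (i) orthogonality: `ψ̂(z) = ∫ ψ · conj q`
  have hψint : IntervalIntegrable ψ volume (-a) a := by
    rw [intervalIntegrable_iff_integrableOn_Ioc_of_le hle]
    exact hψ.integrable one_le_two
  have hconj_q : ∀ x : ℝ, conj (q x) =
      cexp (I * z * x) - ∑ n ∈ S, conj (c n) * cexp (I * (π * ↑(-n) / a) * x) := by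
    intro x
    simp only [hq, map_sub, map_sum, map_mul, ← Complex.exp_conj, map_neg, Complex.conj_I,
      Complex.conj_ofReal, map_div₀, map_intCast]
    congr 1
    · congr 1
      ring
    · refine Finset.sum_congr rfl fun n _ ↦ ?_
      congr 2
      push_cast
      ring
  have h1 : ∫ x in (-a)..a, ψ x * cexp (I * z * x) = ∫ x in (-a)..a, ψ x * conj (q x) := by
    simp_rw [hconj_q, mul_sub, Finset.mul_sum]
    rw [intervalIntegral.integral_sub, intervalIntegral.integral_finsetSum]
    · have hvan : ∀ n ∈ S, ∫ x in (-a)..a, ψ x * (conj (c n) * cexp (I * (π * ↑(-n) / a) * x)) = 0 := by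
        intro n hn
        have hn' : |(-n)| ≤ (N : ℤ) := by rw [abs_neg]; exact (hmemS n).1 hn
        have := horth (-n) hn'
        calc ∫ x in (-a)..a, ψ x * (conj (c n) * cexp (I * (π * ↑(-n) / a) * x))
            = conj (c n) * ∫ x in (-a)..a, ψ x * cexp (I * (π * ↑(-n) / a) * x) := by
              rw [← intervalIntegral.integral_const_mul]
              congr 1
              ext x
              ring
          _ = 0 := by rw [this, mul_zero]
      rw [Finset.sum_eq_zero hvan, sub_zero]
    · intro n _
      exact (hψint.mul_continuousOn (by fun_prop : Continuous fun x : ℝ ↦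
        conj (c n) * cexp (I * (π * ↑(-n) / a) * x)).continuousOn)
    · exact hψint.mul_continuousOn (by fun_prop : Continuous fun x : ℝ ↦ cexp (I * z * x)).continuousOn
    · have hs := IntervalIntegrable.sum S (μ := volume) (a := -a) (b := a)
        (f := fun n (x : ℝ) ↦ ψ x * (conj (c n) * cexp (I * (π * ↑(-n) / a) * x)))
        fun n _ ↦ (hψint.mul_continuousOn (by fun_prop : Continuous fun x : ℝ ↦
          conj (c n) * cexp (I * (π * ↑(-n) / a) * x)).continuousOn)
      rw [Finset.sum_fn] at hs
      exact hs
  -- (ii) Cauchy–Schwarz on the window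
  have hq2 : MemLp q 2 (volume.restrict (Ioc (-a) a)) := memLp_two_Ioc_symm_of_continuous hq_cont
  have hconjq2 : MemLp (fun x ↦ conj (q x)) 2 (volume.restrict (Ioc (-a) a)) :=
    memLp_two_Ioc_symm_of_continuous (Complex.continuous_conj.comp hq_cont)
  have h2 : ‖∫ x in (-a)..a, ψ x * cexp (I * z * x)‖ ^ 2 ≤
      (∫ x in (-a)..a, ‖ψ x‖ ^ 2) * ∫ x in (-a)..a, ‖q x‖ ^ 2 := by
    rw [h1, intervalIntegral.integral_of_le hle, intervalIntegral.integral_of_le hle,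
      intervalIntegral.integral_of_le hle]
    have hcs := norm_integral_mul_le_sqrt_mul_sqrt hψ hconjq2
    simp only [RCLike.norm_conj] at hcs
    have hA : 0 ≤ ∫ x in Ioc (-a) a, ‖ψ x‖ ^ 2 := integral_nonneg fun x ↦ by positivity
    have hB : 0 ≤ ∫ x in Ioc (-a) a, ‖q x‖ ^ 2 := integral_nonneg fun x ↦ by positivity
    calc ‖∫ x in Ioc (-a) a, ψ x * conj (q x)‖ ^ 2
        ≤ (√(∫ x in Ioc (-a) a, ‖ψ x‖ ^ 2) * √(∫ x in Ioc (-a) a, ‖q x‖ ^ 2)) ^ 2 := by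
          gcongr
      _ = (∫ x in Ioc (-a) a, ‖ψ x‖ ^ 2) * ∫ x in Ioc (-a) a, ‖q x‖ ^ 2 := by
          rw [mul_pow, Real.sq_sqrt hA, Real.sq_sqrt hB]
  -- (iii) Parseval for `q`: its coefficients vanish for `|n| ≤ N` and equal `c n` beyond
  have hcoeff : ∀ n : ℤ, fourierCoeffOn hab q n = if |n| ≤ N then 0 else c n := by
    intro n
    have hsub := fourierCoeffOn_sub ha (f := fun x : ℝ ↦ cexp (-(I * z * x)))
      (g := fun x : ℝ ↦ ∑ m ∈ S, c m * cexp (I * (π * m / a) * x)) (by fun_prop) (by fun_prop) n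
    simp only [hq]
    rw [hsub, fourierCoeffOn_finset_sum ha S (fun m ↦ by fun_prop) n]
    simp_rw [fourierCoeffOn.const_mul, fourierCoeffOn_mode ha]
    simp only [mul_ite, mul_one, mul_zero, Finset.sum_ite_eq, hmemS]
    split_ifs with h
    · simp [hc]
    · simp [hc]
  have hpars := hasSum_sq_fourierCoeffOn hab hq2
  simp_rw [hcoeff] at hpars
  -- majorant for the coefficient squares
  set K : ℝ := (2 * (1 + a * |z|) / π) ^ 2 with hK
  have hmaj : ∀ n : ℤ, ‖(if |n| ≤ (N : ℤ) then (0 : ℂ) else c n)‖ ^ 2 ≤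
      K * (if (N : ℤ) < |n| then 1 / (n : ℝ) ^ 2 else 0) := by
    intro n
    by_cases h : |n| ≤ (N : ℤ)
    · have h' : ¬ ((N : ℤ) < |n|) := not_lt.2 h
      simp [h, h']
    · have h' : (N : ℤ) < |n| := lt_of_not_ge h
      rw [if_neg h, if_pos h']
      have hn : n ≠ 0 := by
        rintro rfl
        simp at h
      have hb := norm_fourierCoeffOn_cexp_neg_le ha z hn
      have hnn : 0 ≤ ‖c n‖ := norm_nonneg _
      have hn0 : (n : ℝ) ≠ 0 := by exact_mod_cast hn
      calc ‖c n‖ ^ 2 ≤ (2 * (1 + a * |z|) / (π * |(n : ℝ)|)) ^ 2 := by gcongr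
        _ = K * (1 / (n : ℝ) ^ 2) := by
          simp only [hK, div_pow, mul_pow, sq_abs]
          field_simp
  have htail := tsum_int_inv_sq_tail_le N
  have hsumm_e : Summable fun n : ℤ ↦ (if (N : ℤ) < |n| then 1 / (n : ℝ) ^ 2 else 0) := by
    refine (summable_one_div_int_pow.mpr one_lt_two).of_nonneg_of_le (fun n ↦ ?_) (fun n ↦ ?_)
    · split_ifs <;> positivity
    · split_ifs
      · exact le_rfl
      · positivity
  have hq_int_le : (a - -a)⁻¹ • ∫ x in (-a)..a, ‖q x‖ ^ 2 ≤ K * (4 / (N + 1)) := by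
    refine (hasSum_le hmaj hpars ((hsumm_e.mul_left K).hasSum)).trans ?_
    rw [tsum_mul_left]
    gcongr
  have hq_int : ∫ x in (-a)..a, ‖q x‖ ^ 2 ≤ 2 * a * (K * (4 / (N + 1))) := by
    have h2a : a - -a = 2 * a := by ring
    rw [h2a, smul_eq_mul] at hq_int_le
    have h2a0 : (0 : ℝ) < 2 * a := by positivity
    calc ∫ x in (-a)..a, ‖q x‖ ^ 2 = 2 * a * ((2 * a)⁻¹ * ∫ x in (-a)..a, ‖q x‖ ^ 2) := by
          field_simp
      _ ≤ 2 * a * (K * (4 / (N + 1))) := by gcongr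
  -- (iv) combine
  have hψ0 : 0 ≤ ∫ x in (-a)..a, ‖ψ x‖ ^ 2 :=
    intervalIntegral.integral_nonneg hle fun x _ ↦ by positivity
  calc ‖∫ x in (-a)..a, ψ x * cexp (I * z * x)‖ ^ 2
      ≤ (∫ x in (-a)..a, ‖ψ x‖ ^ 2) * ∫ x in (-a)..a, ‖q x‖ ^ 2 := h2
    _ ≤ (∫ x in (-a)..a, ‖ψ x‖ ^ 2) * (2 * a * (K * (4 / (N + 1)))) := by gcongr
    _ = 32 * a * (1 + a * |z|) ^ 2 / (π ^ 2 * (N + 1)) * ∫ x in (-a)..a, ‖ψ x‖ ^ 2 := by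
      rw [hK]
      field_simp
      ring

end Literature.Analysis.Fourier

end
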